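import Literature.Analysis.Complex.PQFrame
import HarnessLib

/-!
# `∂̄`-closed `(p,0)`-forms on `ℂ^ι` are holomorphic

A flat form `δ : ℂ^ι → Λ^n` of pointwise type `(p,0)` whose `∂̄` vanishes on an open set `U`,
`(dδ)^{p,1} = ∑_j dz̄_j ∧ ∂δ/∂z̄_j = 0`, has `∂δ/∂z̄_j = 0` on `U` for every coordinate
(`dbarAlong_eq_zero_of_sum_wedgeOne_dzBar_eq_zero`: contract with `∂/∂z̄_k` and use that forms
of type `(p,0)` are killed by the contractions), hence is complex-differentiable on `U` as a map
into `Λ^n` (`differentiableOn_complex_of_typeZero`). This is the remark "a `(p,0)`-form `u` with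
`∂̄u = 0` has holomorphic coefficients" (Hörmander (1973), §2.1, after (2.1.5); used in the proof
of Thm. 2.7.8, case `q = 0`).

## References

* L. Hörmander, *An Introduction to Complex Analysis in Several Variables*, 2nd ed. (1973),
  §2.1 and proof of Thm. 2.7.8. [HormanderSCV1973]
-/

noncomputable section

open scoped ComplexConjugate
open Complex Function ContinuousAlternatingMap
open Literature.LinearAlgebra.Alternating

namespace Literature.Analysis.Complex

variable {ι : Type*} [Fintype ι] [DecidableEq ι]

/-- If `∑_j dz̄_j ∧ η_j = 0` for forms `η_j` of type `(p,0)`, then every `η_j = 0` (contract with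
`∂/∂z̄_k`: the contractions kill `(p,0)`-forms). [cite: HormanderSCV1973, §2.1] -/
theorem eq_zero_of_sum_wedgeOne_dzBar_eq_zero {n p : ℕ} {η : ι → (ι → ℂ) [⋀^Fin n]→L[ℝ] ℂ}
    (hη : ∀ j, IsOfTypeAt p 0 (η j)) (h : ∑ j, wedgeOne (dzBar j) (η j) = 0) (k : ι) : η k = 0 := by
  have hk := congr_arg (dbarContract (F := ℂ) (Pi.single k (1 : ℂ))) h
  rw [_root_.map_sum, _root_.map_zero] at hk
  cases n with
  | zero =>
    simp only [dbarContract_single_wedgeOne_dzBar_zero, Finset.sum_ite_eq, Finset.mem_univ,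
      if_true] at hk
    exact hk
  | succ m =>
    have hp : p = m + 1 := by have := (hη k).1; omega
    subst hp
    have h0 : ∀ j, dbarContract (Pi.single k (1 : ℂ)) (η j) = 0 := fun j =>
      (hη j).dbarContract_eq_zero_of_type_zero _
    have h1 : ∀ j, dbarContract (Pi.single k (1 : ℂ)) (wedgeOne (dzBar j) (η j)) =
        if k = j then η j else 0 := fun j => by
      have := dbarContract_single_wedgeOne_dzBar k j (η j)
      rwa [h0 j, wedgeOne_zero, add_zero] at this
    simp only [h1, Finset.sum_ite_eq, Finset.mem_univ, if_true] at hk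
    exact hk

/-- For a differentiable flat form `δ` of type `(p,0)` with `(dδ)^{p,1}(x) = 0`, all
`∂δ/∂z̄_j (x)` vanish. [cite: HormanderSCV1973, §2.1] -/
theorem dbarAlong_single_eq_zero_of_typeZero {n p : ℕ} {δ : (ι → ℂ) → (ι → ℂ) [⋀^Fin n]→L[ℝ] ℂ}
    (ht : ∀ y, IsOfTypeAt p 0 (δ y)) {x : ι → ℂ} (hd : DifferentiableAt ℝ δ x)
    (hc : typeProjAt p 1 (extDeriv δ x) = 0) (j : ι) : dbarAlong (Pi.single j 1) δ x = 0 := by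
  rw [typeProjAt_extDeriv_eq_sum ht] at hc
  exact eq_zero_of_sum_wedgeOne_dzBar_eq_zero (fun j => IsOfTypeAt.dbarAlong ht hd _) hc j

/-- **`∂̄`-closed `(p,0)`-forms are holomorphic**: a flat form `δ : ℂ^ι → Λ^n` of pointwise type
`(p,0)`, real-differentiable on an open set `U` with `(dδ)^{p,1} = 0` on `U`, is
complex-differentiable on `U` (Hörmander (1973), §2.1: `∂̄u = 0` for a `(p,0)`-form means
holomorphic coefficients). [cite: HormanderSCV1973, §2.1] -/
theorem differentiableOn_complex_of_typeZero {n p : ℕ} {δ : (ι → ℂ) → (ι → ℂ) [⋀^Fin n]→L[ℝ] ℂ}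
    {U : Set (ι → ℂ)} (hU : IsOpen U) (hd : DifferentiableOn ℝ δ U) (ht : ∀ y, IsOfTypeAt p 0 (δ y))
    (hc : ∀ x ∈ U, typeProjAt p 1 (extDeriv δ x) = 0) : DifferentiableOn ℂ δ U :=
  differentiableOn_complex_of_forall_single hU hd fun x hx j =>
    dbarAlong_single_eq_zero_of_typeZero ht (hd.differentiableAt (hU.mem_nhds hx)) (hc x hx) j

end Literature.Analysis.Complex
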